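import Literature.Barriers.NavierStokesRegularity.NavierStokesInequalityPressureContinuity
import Literature.Barriers.NavierStokesRegularity.NavierStokesInequalityPressureSymmetry
import Literature.Barriers.NavierStokesRegularity.NavierStokesInequalityStructureRecipe
import HarnessLib

/-!
# The planar pressure of `u[bv, f]` is affine in `b²` (Ożański 2017, §4.1/§4.3, Lemma 3.2 (i))

Barrier catalogue support file for `NavierStokesRegularity` (D-0021), on the discharge path of
fact D-II `Literature.Barriers.NavierStokesRegularity.NSIProfiles_of_arrangement`
(`NavierStokesInequalityProfiles`; W. S. Ożański, arXiv:1709.00602v4, §4.1–4.3). The profiles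
`qᵏᵢ,ₜ` of (4.16) integrate `aᵢᵏ(s) vᵢ·∇p[aⱼᵏ(s)vⱼ, hⱼ,ₛ]`, and Theorem 4.3 (existence of the
oscillatory processes) is applied to the functions
`F_{i,l}(x,t,b) = 2vᵢ(x)·∇p[b v_l, h_{l,t}](x)`, `b ∈ [-1,1]`, which must be bounded, uniformly
continuous in `(x,t,b)` and even in `b` (`F_{i,l}(x,t,-1) = F_{i,l}(x,t,1)`, from Lemma 3.2 (i),
the tree's `planePressure_neg`). This file PROVES the structural identity that makes the
dependence on the direction factor `b` explicit:

* `IsNSIStructure.planePressure_smul_eq` — for a structure `(v,f,φ)` on `U` and `|b| ≤ 1`,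
  **`p[bv, f] = p[0, f] + b² (p[v, f] - p[0, f])`** on the whole plane; hence
* `IsNSIStructure.derivR_planePressure_smul`, `….derivZ_planePressure_smul` —
  **`∇p[bv, f] = ∇p[0, f] - b² F[v, f]`** with the pressure interaction function
  `F[v,f] = ∇p[0,f] - ∇p[v,f]` of (3.34).

So `F_{i,l}(x,t,b) = 2vᵢ·∇p[0,h_{l,t}] - 2b² vᵢ·F[v_l,h_{l,t}]` is a polynomial in `b`, even, and
its regularity in `(x,t,b)` is that of the one-parameter families `t ↦ ∇p[0,h_{l,t}]`,
`t ↦ F[v_l,h_{l,t}]`; and the limit `½(F_{2,1}(x,t,1) - F_{2,1}(x,t,0)) = -v₂·F[v₁,h_{1,t}]` of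
(4.22) is read off.

## Proof

With `u[v,f] = v_r ρ̂ + v_z x̂_axis + √(f² - |v|²) φ̂` ((3.10)–(3.12)) one has, for `b ≠ 0`,
`u[bv, |b|f] = |b| u[±v, f]` (`swirlField_smul_of_nonneg`), so `p[bv, |b|f] = b² p[v,f]`
(`p̃` is 2-homogeneous, `normalisedPressure_smul`, and `p[-v,f] = p[v,f]`, `planePressure_neg`);
and the sources `G = ∂ᵢ∂ⱼ(uᵢuⱼ)` of `u[w,f]`, `u[w,|b|f]` differ by `-r⁻¹∂ᵣ((1-b²)f²)` for ANY
admissible poloidal part `w` (`IsNSIStructure.pressureSource_swirlField_sub`, Ożański App. A.3: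
"all the terms that include the components of `v_k`'s vanish"), in particular for `w = bv` and
for `w = 0`. Since `p̃[u₁] - p̃[u₂]` is the Newtonian potential of `G[u₁] - G[u₂]`
(`normalisedPressure_sub_eq_neg_integral`), `p[bv,f] - b²p[v,f] = p[0,f] - b²p[0,f]`.

## References

* W. S. Ożański, *On weak solutions to the Navier–Stokes inequality with internal
  singularities*, arXiv:1709.00602v4, §3.3 (3.10)–(3.12), (3.19)–(3.21), Lemma 3.2 (i), §3.6
  (3.34), §4.1 (4.16), §4.3 (4.22) and Theorem 4.3, App. A.3. [`Ozanski2017NSISingular`]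
* V. Scheffer, *A solution to the Navier–Stokes inequality with an internal singularity*,
  Comm. Math. Phys. 101 (1985), 47–85, Lemma 3.2. [`Scheffer1985`]
-/

noncomputable section

open MeasureTheory Set Function Filter Topology TopologicalSpace WithLp Metric
open scoped ENNReal InnerProductSpace RealInnerProductSpace ContDiff

namespace Literature.Barriers.NavierStokesRegularity

open Literature.Analysis.FluidPDE

variable {U : Set (ℝ × ℝ)} {v : ℝ × ℝ → ℝ × ℝ} {f φ : ℝ × ℝ → ℝ}

/-! ### Scaling the data of `u[v,f]` -/

/-- **`u[cv, cf] = c u[v,f]` for `c ≥ 0`** (from (3.12): all three components scale).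
[cite: Ozanski2017NSISingular, §3.3 (3.12)] -/
theorem swirlField_smul_of_nonneg {c : ℝ} (hc : 0 ≤ c) (v : ℝ × ℝ → ℝ × ℝ) (f : ℝ × ℝ → ℝ) :
    swirlField (c • v) (fun q => c * f q) = c • swirlField v f := by
  funext x
  simp only [swirlField, Pi.smul_apply, Prod.smul_fst, Prod.smul_snd, smul_eq_mul]
  have h1 : (c * f (meridian x)) ^ 2 -
      ((c * (v (meridian x)).1) ^ 2 + (c * (v (meridian x)).2) ^ 2) =
      c ^ 2 * (f (meridian x) ^ 2 - ((v (meridian x)).1 ^ 2 + (v (meridian x)).2 ^ 2)) := by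
    ring
  rw [h1, Real.sqrt_mul (sq_nonneg c), Real.sqrt_sq hc, smul_add, smul_add, smul_smul, smul_smul,
    smul_smul]

/-- **`p[cv, cf] = c² p[v,f]` for `c ≥ 0`** (`p̃` is quadratic).
[cite: Ozanski2017NSISingular, §3.3 (3.19)–(3.20)] -/
theorem planePressure_smul_of_nonneg {c : ℝ} (hc : 0 ≤ c) (v : ℝ × ℝ → ℝ × ℝ) (f : ℝ × ℝ → ℝ) :
    planePressure (c • v) (fun q => c * f q) = fun q => c ^ 2 * planePressure v f q := by
  funext q
  rw [planePressure, planePressure, swirlField_smul_of_nonneg hc, normalisedPressure_smul]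

/-- **`p[bv, |b|f] = b² p[v,f]` for every real `b`** (for `b < 0` write `bv = |b|(-v)` and use
Lemma 3.2 (i), `p[-v,f] = p[v,f]`). [cite: Ozanski2017NSISingular, Lemma 3.2 (i)] -/
theorem planePressure_smul_abs (b : ℝ) (v : ℝ × ℝ → ℝ × ℝ) (f : ℝ × ℝ → ℝ) :
    planePressure (b • v) (fun q => |b| * f q) = fun q => b ^ 2 * planePressure v f q := by
  rcases le_or_gt 0 b with hb | hb
  · rw [abs_of_nonneg hb]
    exact planePressure_smul_of_nonneg hb v f
  · have h1 : b • v = |b| • (-v) := by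
      rw [abs_of_neg hb, smul_neg, neg_smul, neg_neg]
    rw [h1, planePressure_smul_of_nonneg (abs_nonneg b), planePressure_neg, sq_abs]

namespace IsNSIStructure

/-- **`(bv, |b|f, φ)` is a structure for `0 < |b| ≤ 1` whenever `(v,f,φ)` is** (all the
conditions of Definition 3.3 scale; `L(|b|f) = |b| Lf`).
[cite: Ozanski2017NSISingular, Definition 3.3 (remark after it)] -/
theorem smul_abs (h : IsNSIStructure U v f φ) {b : ℝ} (hb0 : b ≠ 0) (hb : |b| ≤ 1) :
    IsNSIStructure U (b • v) (fun q => |b| * f q) φ where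
  isOpen := h.isOpen
  isCompact_closure := h.isCompact_closure
  closure_subset := h.closure_subset
  v_smooth := (h.smul hb).v_smooth
  f_smooth := contDiff_const.mul h.f_smooth
  φ_smooth := h.φ_smooth
  f_nonneg q := mul_nonneg (abs_nonneg b) (h.f_nonneg q)
  φ_mem := h.φ_mem
  tsupport_f := by rw [tsupport_const_mul (abs_ne_zero.2 hb0), h.tsupport_f]
  tsupport_φ := h.tsupport_φ
  tsupport_v := (h.smul hb).tsupport_v
  div_eq_zero := (h.smul hb).div_eq_zero
  sq_lt q hq := by
    have h1 := h.sq_lt q hq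
    have hb2 : 0 < b ^ 2 := by positivity
    calc ((b • v) q).1 ^ 2 + ((b • v) q).2 ^ 2 = b ^ 2 * ((v q).1 ^ 2 + (v q).2 ^ 2) := by
          simp; ring
      _ < b ^ 2 * f q ^ 2 := mul_lt_mul_of_pos_left h1 hb2
      _ = (|b| * f q) ^ 2 := by rw [mul_pow, sq_abs]
  opL_pos q hq hφ := by
    rw [opL_const_mul (contDiff_infty.1 h.f_smooth 2) |b| q]
    exact mul_pos (abs_pos.2 hb0) (h.opL_pos q hq hφ)

/-- The sources of `u[bv,f]`, `u[bv,|b|f]` and of `u[0,f]`, `u[0,|b|f]` have the same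
difference (`= -r⁻¹∂ᵣ((1-b²)f²) ∘ R⁻¹`: "all the terms that include the components of `v`
vanish"). [cite: Ozanski2017NSISingular, App. A.3, first lemma (proof)] -/
theorem pressureSource_smul_sub (h : IsNSIStructure U v f φ) {b : ℝ} (hb0 : b ≠ 0) (hb : |b| ≤ 1)
    (x : EuclideanSpace ℝ (Fin 3)) :
    pressureSource (swirlField (b • v) f) x -
        pressureSource (swirlField (b • v) (fun q => |b| * f q)) x =
      pressureSource (swirlField 0 f) x - pressureSource (swirlField 0 (fun q => |b| * f q)) x := by
  rw [(h.smul hb).pressureSource_swirlField_sub (h.smul_abs hb0 hb) x,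
    h.zero_field.pressureSource_swirlField_sub (h.smul_abs hb0 hb).zero_field x]

/-- **`p[bv, f] = p[0, f] + b²(p[v, f] - p[0, f])` for `|b| ≤ 1`**: the planar pressure of
`u[bv,f]` is affine in `b²` (the difference of pressures being the Newtonian potential of the
difference of the sources, which does not see the poloidal part).
[cite: Ozanski2017NSISingular, Lemma 3.2 (i) and App. A.3 (first lemma, proof)] -/
theorem planePressure_smul_eq (h : IsNSIStructure U v f φ) {b : ℝ} (hb : |b| ≤ 1) :
    planePressure (b • v) f =
      fun q => planePressure 0 f q + b ^ 2 * (planePressure v f q - planePressure 0 f q) := by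
  funext q
  rcases eq_or_ne b 0 with rfl | hb0
  · simp
  · have hA := h.smul hb
    have hB := h.smul_abs hb0 hb
    have hC := h.zero_field
    have hD := hB.zero_field
    have key : ∀ y : EuclideanSpace ℝ (Fin 3),
        normalisedPressure (swirlField (b • v) f) y -
            normalisedPressure (swirlField (b • v) (fun q => |b| * f q)) y =
          normalisedPressure (swirlField 0 f) y -
            normalisedPressure (swirlField 0 (fun q => |b| * f q)) y := by
      intro y
      rw [normalisedPressure_sub_eq_neg_integral (contDiff_infty.1 hA.contDiff_swirlField 2)
          hA.hasCompactSupport_swirlField (contDiff_infty.1 hB.contDiff_swirlField 2)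
          hB.hasCompactSupport_swirlField,
        normalisedPressure_sub_eq_neg_integral (contDiff_infty.1 hC.contDiff_swirlField 2)
          hC.hasCompactSupport_swirlField (contDiff_infty.1 hD.contDiff_swirlField 2)
          hD.hasCompactSupport_swirlField]
      congr 1
      refine integral_congr_ae (Eventually.of_forall fun z => ?_)
      simp only
      rw [h.pressureSource_smul_sub hb0 hb z]
    have e1 : planePressure (b • v) f q - planePressure (b • v) (fun q => |b| * f q) q =
        planePressure 0 f q - planePressure 0 (fun q => |b| * f q) q := key (meridianPoint q)
    have hBD : planePressure (b • v) (fun q => |b| * f q) q = b ^ 2 * planePressure v f q :=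
      congrFun (planePressure_smul_abs b v f) q
    have hD' : planePressure 0 (fun q => |b| * f q) q = b ^ 2 * planePressure 0 f q := by
      have := congrFun (planePressure_smul_abs b (0 : ℝ × ℝ → ℝ × ℝ) f) q
      rwa [smul_zero] at this
    rw [hBD, hD'] at e1
    linarith

/-- **`∂ᵣ p[bv,f] = ∂ᵣ p[0,f] - b² F[v,f]ᵣ`** for `|b| ≤ 1` (planar gradient of
`planePressure_smul_eq`; `F[v,f] = ∇p[0,f] - ∇p[v,f]`, (3.34)).
[cite: Ozanski2017NSISingular, §3.6 (3.34) and Lemma 3.2 (i)] -/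
theorem derivR_planePressure_smul (h : IsNSIStructure U v f φ) {b : ℝ} (hb : |b| ≤ 1) (q : ℝ × ℝ) :
    derivR (planePressure (b • v) f) q =
      derivR (planePressure 0 f) q - b ^ 2 * (pressureInteraction v f q).1 := by
  have h0 : Differentiable ℝ (planePressure 0 f) :=
    h.contDiff_planePressure_zero.differentiable (by simp)
  have h1 : Differentiable ℝ (planePressure v f) := h.contDiff_planePressure.differentiable (by simp)
  have hd : HasFDerivAt
      (fun q => planePressure 0 f q + b ^ 2 * (planePressure v f q - planePressure 0 f q))
      (fderiv ℝ (planePressure 0 f) q +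
        b ^ 2 • (fderiv ℝ (planePressure v f) q - fderiv ℝ (planePressure 0 f) q)) q :=
    (h0 q).hasFDerivAt.add (((h1 q).hasFDerivAt.sub (h0 q).hasFDerivAt).const_mul (b ^ 2))
  rw [h.planePressure_smul_eq hb, derivR, hd.fderiv]
  simp only [pressureInteraction, derivR, _root_.add_apply, FunLike.coe_smul, Pi.smul_apply,
    FunLike.coe_sub, Pi.sub_apply, smul_eq_mul]
  ring

/-- **`∂_z p[bv,f] = ∂_z p[0,f] - b² F[v,f]_z`** for `|b| ≤ 1`.
[cite: Ozanski2017NSISingular, §3.6 (3.34) and Lemma 3.2 (i)] -/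
theorem derivZ_planePressure_smul (h : IsNSIStructure U v f φ) {b : ℝ} (hb : |b| ≤ 1) (q : ℝ × ℝ) :
    derivZ (planePressure (b • v) f) q =
      derivZ (planePressure 0 f) q - b ^ 2 * (pressureInteraction v f q).2 := by
  have h0 : Differentiable ℝ (planePressure 0 f) :=
    h.contDiff_planePressure_zero.differentiable (by simp)
  have h1 : Differentiable ℝ (planePressure v f) := h.contDiff_planePressure.differentiable (by simp)
  have hd : HasFDerivAt
      (fun q => planePressure 0 f q + b ^ 2 * (planePressure v f q - planePressure 0 f q))
      (fderiv ℝ (planePressure 0 f) q +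
        b ^ 2 • (fderiv ℝ (planePressure v f) q - fderiv ℝ (planePressure 0 f) q)) q :=
    (h0 q).hasFDerivAt.add (((h1 q).hasFDerivAt.sub (h0 q).hasFDerivAt).const_mul (b ^ 2))
  rw [h.planePressure_smul_eq hb, derivZ, hd.fderiv]
  simp only [pressureInteraction, derivZ, _root_.add_apply, FunLike.coe_smul, Pi.smul_apply,
    FunLike.coe_sub, Pi.sub_apply, smul_eq_mul]
  ring

/-- **The transport pairing is a polynomial in the direction factor**: for `|b| ≤ 1` and any
planar vector `w`,
`w·∇p[bv,f] = w·∇p[0,f] - b² w·F[v,f]` — the form in which `F_{i,l}(x,t,b) = 2vᵢ·∇p[bv_l,h_{l,t}]`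
enters Theorem 4.3, even in `b`, with `½(F_{2,1}(·,·,1) - F_{2,1}(·,·,0)) = -v₂·F[v₁,h₁,ₜ]`
((4.22) versus (4.9)). [cite: Ozanski2017NSISingular, §4.3 (4.22) and Theorem 4.3] -/
theorem inner_grad_planePressure_smul (h : IsNSIStructure U v f φ) {b : ℝ} (hb : |b| ≤ 1)
    (w q : ℝ × ℝ) :
    w.1 * derivR (planePressure (b • v) f) q + w.2 * derivZ (planePressure (b • v) f) q =
      (w.1 * derivR (planePressure 0 f) q + w.2 * derivZ (planePressure 0 f) q) -
        b ^ 2 * (w.1 * (pressureInteraction v f q).1 + w.2 * (pressureInteraction v f q).2) := by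
  rw [h.derivR_planePressure_smul hb, h.derivZ_planePressure_smul hb]
  ring

end IsNSIStructure

end Literature.Barriers.NavierStokesRegularity
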